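import Mathlib
import Literature.Barriers.PneNP.TSPExtensionComplexity
import Literature.Barriers.PneNP.TSPExtensionComplexityFaces
import Literature.Barriers.PneNP.ExtendedFormulationLinearImage
import Literature.Combinatorics.SimpleGraph.SubcubicMinors
import Literature.Combinatorics.Optimization.CutPolytopeMinorMonotone
import HarnessLib

/-!
# Extension complexity of cut polytopes is minor-monotone — discharge of `AvisTiwary2015_thm12`

D-0014 keeps `Literature/` sorry-free by stating cited results as named facts.  This file proves the
named fact `Literature.Combinatorics.Optimization.AvisTiwary2015_thm12` of
`CutPolytopeMinorMonotone.lean` — D. Avis, H. R. Tiwary, *On the extension complexity of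
combinatorial polytopes*, Math. Program. 153 (2015) 95–115 = arXiv:1302.2340, Theorem 12 (§4.1):
"Let `G` be a graph and `H` be a minor of `G`. Then `xc(CUT□(G)) ≥ xc(CUT□(H))`", in the tree's
currency: `IsMinor H G → ∀ r, HasEFOfSize (cutPolytope G) r → HasEFOfSize (cutPolytope H) r`.

* `Literature.Combinatorics.Optimization.AvisTiwary2015_thm12_holds : AvisTiwary2015_thm12`.

## The printed proof and the one formalised

Avis–Tiwary prove Theorem 12 by composing three single-step lemmas along a sequence of minor
operations: Lemma 3 (delete an edge `e`: `CUT□(G)` is an extension of `CUT□(H)` — project `x_e`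
out; cut vectors project to cut vectors and lift back), Lemma 4 (delete a vertex: the same),
Lemma 5 (contract `e = uv`: `CUT□(H)` is the projection of the face `F = CUT□(G) ∩ {x_e = 0}`,
projecting out `x_e` and one of each pair of parallel edges `x_{vw}`, `x_{uw}`; lift by `x_e = 0`,
`x_{vw} = x_{uw}`), and Propositions 1–2 (`xc` is monotone under projections and faces).

The tree's notion of minor (`Literature.Combinatorics.SimpleGraph.IsMinor`, Diestel's branch sets:
a partial map `φ : V(G) → Option V(H)` with non-empty connected fibres and an edge of `G` between the
fibres of the ends of every edge of `H`) packages a whole sequence of such operations, so we apply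
the three printed constructions SIMULTANEOUSLY instead of inducting:

* *the face* (Lemma 5 for all contracted edges at once): `F := CUT□(G) ∩ {x_g = 0 : g an edge of G
  inside a branch set}`.  Each `x_g ≥ 0` is valid because cut vectors are `0/1`, so `F` is the convex
  hull of the cut vectors `δ_G(T)` lying in it (`convexHull_inter_coord_zero`), and these are exactly
  the cuts `T` that split no branch set — along a walk inside a branch set a cut with `x_g = 0` on
  its edges does not change sides (`walk_const`, using clause (ii) of `IsMinor`);
* *the projection* (Lemmas 3 and 5): choose for every edge `e = uv` of `H` a representative edge
  `f(e)` of `G` between the branch sets of `u` and `v` (clause (iii)) and project by the linear map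
  `x ↦ x ∘ f` (all other coordinates — deleted edges, edges at deleted vertices, duplicate parallel
  edges — are dropped);
* *vertices correspond* (the "projects to a vertex … can be lifted to a vertex" sentences of
  Lemmas 3–5): a cut `S` of `H` lifts to the cut `⋃_{u ∈ S} branch(u)` of `G`, which lies in `F`
  and projects to `δ_H(S)` (`lift_comp`); a cut `T` of `G` in `F` is a union of branch sets plus
  unused vertices and projects to `δ_H({u | branch(u) ⊆ T})` (`desc_comp`).  Hence
  `CUT□(H) = (· ∘ f)(F)` (`LinearMap.image_convexHull`);
* *Propositions 1–2* in slack form, both LOSSLESS: `HasEFOfSize.inter_eqs`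
  (`TSPExtensionComplexityFaces.lean`) for the face and `HasEFOfSize.image_linearMap`
  (`ExtendedFormulationLinearImage.lean`) for the projection.  So the printed inequality is obtained
  exactly, with no additive loss.

No new definition, no named fact.

## References

* D. Avis, H. R. Tiwary, *On the extension complexity of combinatorial polytopes*, Math. Program.
  153 (2015), 95–115 = arXiv:1302.2340: §2.1 (cut vectors and `CUT□(G)`, p. 5), Propositions 1–2
  (p. 6), §4.1: minors (p. 12, "contracting some edges, deleting some edges and isolated vertices,
  and relabeling"), Lemmas 3–5 (pp. 12–13), Theorem 12 (p. 13).  Bib key `AvisTiwary2015`.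
* S. Fiorini, S. Massar, S. Pokutta, H. R. Tiwary, R. de Wolf, *Exponential lower bounds for
  polytopes in combinatorial optimization*, J. ACM 62 (2015) = arXiv:1111.0837, Lemma 9 (p. 10:
  extensions and faces).  Bib key `FioriniEtAl2015`.
* R. Diestel, *Graph Theory*, 4th ed., Springer GTM 173 (2010), §1.7 (minors, branch sets) — the
  source of the tree's `IsMinor`.  Bib key `Diestel2010`.
-/

noncomputable section

namespace Literature.Combinatorics.Optimization

open Matrix Finset SimpleGraph
open Literature.Barriers.PneNP (HasEFOfSize)
open Literature.Combinatorics.SimpleGraph (IsMinor)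

/-- Faces cut out by coordinate hyperplanes: for a finite set `S` of points that are non-negative in
the coordinates `i ∈ I`, `conv(S) ∩ {x_i = 0 ∀ i ∈ I} = conv {y ∈ S | y_i = 0 ∀ i ∈ I}` (a convex
combination vanishing in coordinate `i` puts no weight on points positive there).  This is why
`x_e ≥ 0` "is a valid inequality for `CUT□(G)`" whose face is spanned by cut vectors (Lemma 5).
[cite: AvisTiwary2015, proof of Lemma 5 (arXiv:1302.2340 p. 13)] -/
private theorem convexHull_inter_coord_zero {ι : Type} (S : Finset (ι → ℝ)) (I : Set ι)
    (hS : ∀ y ∈ S, ∀ i ∈ I, 0 ≤ y i) :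
    convexHull ℝ (↑S : Set (ι → ℝ)) ∩ {x | ∀ i ∈ I, x i = 0} =
      convexHull ℝ {y | y ∈ S ∧ ∀ i ∈ I, y i = 0} := by
  classical
  set T : Finset (ι → ℝ) := S.filter fun y => ∀ i ∈ I, y i = 0 with hTdef
  have hT : {y | y ∈ S ∧ ∀ i ∈ I, y i = 0} = (↑T : Set (ι → ℝ)) := by
    ext y; simp [hTdef]
  rw [hT]
  have hsub : T ⊆ S := Finset.filter_subset _ _
  apply Set.Subset.antisymm
  · rintro x ⟨hx, hxK⟩
    obtain ⟨w, hw0, hw1, hwx⟩ := Finset.mem_convexHull.1 hx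
    have key : ∀ y ∈ S, y ∉ T → w y = 0 := by
      intro y hy hyT
      have hnot : ¬ ∀ i ∈ I, y i = 0 := fun h => hyT (Finset.mem_filter.2 ⟨hy, h⟩)
      push Not at hnot
      obtain ⟨i, hi, hyi⟩ := hnot
      have hxi : x i = ∑ y ∈ S, w y * y i := by
        rw [← hwx, Finset.centerMass_eq_of_sum_1 _ _ hw1, Finset.sum_apply]
        simp
      have hsum0 : ∑ y ∈ S, w y * y i = 0 := by rw [← hxi]; exact hxK i hi
      have hterm := (Finset.sum_eq_zero_iff_of_nonneg (fun y hy =>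
        mul_nonneg (hw0 y hy) (hS y hy i hi))).1 hsum0 _ hy
      rcases mul_eq_zero.1 hterm with h | h
      · exact h
      · exact absurd h hyi
    refine Finset.mem_convexHull.2 ⟨w, fun y hy => hw0 y (hsub hy), ?_, ?_⟩
    · rw [Finset.sum_subset hsub key]; exact hw1
    · rw [Finset.centerMass_subset _ hsub key]; exact hwx
  · refine Set.subset_inter (convexHull_mono (Finset.coe_subset.2 hsub)) ?_
    refine convexHull_min ?_ ?_
    · intro y hy i hi
      exact ((Finset.mem_filter.1 (Finset.mem_coe.1 hy)).2 i hi)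
    · intro x hx y hy a b _ _ _ i hi
      simp [hx i hi, hy i hi]

/-- The value of a cut vector `δ(S)` on an edge `xy` vanishes iff `x` and `y` lie on the same side of
`S`. [cite: AvisTiwary2015, §2.1 (cut vectors; arXiv p. 5)] -/
private theorem cutVec_mk_eq_zero_iff {V : Type} [DecidableEq V] (G : SimpleGraph V) (S : Finset V)
    (x y : V) (h : s(x, y) ∈ G.edgeSet) :
    cutVec G S ⟨s(x, y), h⟩ = 0 ↔ (x ∈ S ↔ y ∈ S) := by
  rw [cutVec_apply_mk]
  by_cases hx : x ∈ S <;> by_cases hy : y ∈ S <;> simp [hx, hy]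

/-- Cut vectors of two graphs agree on edges `xy`, `uv` whose endpoints lie on corresponding sides —
the bookkeeping behind "every vertex of `CUT□(G)` projects to a vertex of `CUT□(H)` and every vertex of
`CUT□(H)` can be lifted". [cite: AvisTiwary2015, proof of Lemma 3 (arXiv p. 12)] -/
private theorem cutVec_mk_congr {V W : Type} [DecidableEq V] [DecidableEq W] (G : SimpleGraph V)
    (H : SimpleGraph W) (S : Finset V) (T : Finset W) (x y : V) (u v : W) (h : s(x, y) ∈ G.edgeSet)
    (h' : s(u, v) ∈ H.edgeSet) (hx : x ∈ S ↔ u ∈ T) (hy : y ∈ S ↔ v ∈ T) :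
    cutVec G S ⟨s(x, y), h⟩ = cutVec H T ⟨s(u, v), h'⟩ := by
  rw [cutVec_apply_mk, cutVec_apply_mk]
  have h1 : decide (x ∈ S) = decide (u ∈ T) := by rw [decide_eq_decide]; exact hx
  have h2 : decide (y ∈ S) = decide (v ∈ T) := by rw [decide_eq_decide]; exact hy
  rw [h1, h2]

/-- **Avis–Tiwary 2015, Theorem 12 — proved**: for `H` a minor of `G` (the tree's `IsMinor`: branch
sets as fibres of a partial map `φ : V(G) → Option V(H)`), every slack-form extended formulation of
`CUT□(G)` with `r` inequalities yields one of `CUT□(H)` with `r` inequalities, i.e.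
`xc(CUT□(H)) ≤ xc(CUT□(G))`.  Discharge of the named fact `AvisTiwary2015_thm12` of
`CutPolytopeMinorMonotone.lean`.
[cite: AvisTiwary2015, Thm. 12, Lemmas 3–5, Props. 1–2 (§4.1; arXiv:1302.2340 pp. 6, 12–13)] -/
theorem AvisTiwary2015_thm12_holds :
    Literature.Combinatorics.Optimization.AvisTiwary2015_thm12 := by
  intro α β _ _ _ _ H G _ _ hmin r hG
  classical
  obtain ⟨φ, hne, hconn, hadj⟩ := hmin
  -- (iii) representative edges
  have hrep : ∀ e : H.edgeSet, ∃ q : (β × β) × (α × α), G.Adj q.1.1 q.1.2 ∧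
      (e : Sym2 α) = s(q.2.1, q.2.2) ∧ φ q.1.1 = some q.2.1 ∧ φ q.1.2 = some q.2.2 := by
    rintro ⟨e, he⟩
    induction e using Sym2.ind with
    | _ u v =>
      obtain ⟨x, y, hx, hy, hxy⟩ := hadj u v ((SimpleGraph.mem_edgeSet H).1 he)
      exact ⟨((x, y), (u, v)), hxy, rfl, hx, hy⟩
  choose q hq using hrep
  have hqe : ∀ e : H.edgeSet, s((q e).2.1, (q e).2.2) ∈ H.edgeSet := fun e => (hq e).2.1 ▸ e.2
  have hqe' : ∀ e : H.edgeSet, e = ⟨s((q e).2.1, (q e).2.2), hqe e⟩ := fun e => Subtype.ext (hq e).2.1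
  let f : H.edgeSet → G.edgeSet := fun e =>
    ⟨s((q e).1.1, (q e).1.2), (SimpleGraph.mem_edgeSet G).2 (hq e).1⟩
  -- intra-branch-set edges and the face `F`
  let intra : G.edgeSet → Prop := fun g =>
    ∃ x y : β, (g : Sym2 β) = s(x, y) ∧ φ x = φ y ∧ φ x ≠ none
  let K : Set (G.edgeSet → ℝ) := {z | ∀ g, intra g → z g = 0}
  -- good cuts of `G`: those not splitting a branch set
  let good : Finset β → Prop := fun T => ∀ g, intra g → cutVec G T g = 0
  have good_iff : ∀ T, good T ↔ ∀ x y, G.Adj x y → φ x = φ y → φ x ≠ none → (x ∈ T ↔ y ∈ T) := by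
    intro T
    constructor
    · intro hT x y hxy hφ hnn
      have := hT ⟨s(x, y), (SimpleGraph.mem_edgeSet G).2 hxy⟩ ⟨x, y, rfl, hφ, hnn⟩
      exact (cutVec_mk_eq_zero_iff G T x y _).1 this
    · rintro hT ⟨g, hg⟩ ⟨x, y, hgxy, hφ, hnn⟩
      have hg' : s(x, y) ∈ G.edgeSet := by rw [← hgxy]; exact hg
      have : (⟨g, hg⟩ : G.edgeSet) = ⟨s(x, y), hg'⟩ := Subtype.ext hgxy
      rw [this, cutVec_mk_eq_zero_iff]
      exact hT x y ((SimpleGraph.mem_edgeSet G).1 hg') hφ hnn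
  -- along a walk inside a branch set a good cut does not change sides
  have walk_const : ∀ T, good T → ∀ (x y : β) (p : G.Walk x y),
      (∀ z ∈ p.support, φ z = φ x) → φ x ≠ none → (x ∈ T ↔ y ∈ T) := by
    intro T hT x y p
    induction p with
    | nil => intros; exact Iff.rfl
    | @cons a b c hab p ih =>
      intro hsupp hnn
      have hb : φ b = φ a := hsupp b (by simp)
      have h1 : a ∈ T ↔ b ∈ T := (good_iff T).1 hT a b hab hb.symm hnn
      have h2 : b ∈ T ↔ c ∈ T :=
        ih (fun z hz => (hsupp z (by simp [hz])).trans hb.symm) (by rwa [hb])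
      exact h1.trans h2
  -- a good cut contains a branch set or misses it
  have branch_const : ∀ T, good T → ∀ (x x' : β) (u : α), φ x = some u → φ x' = some u →
      (x ∈ T ↔ x' ∈ T) := by
    intro T hT x x' u hx hx'
    obtain ⟨p, hp⟩ := hconn x x' (by rw [hx, hx']) (by rw [hx]; exact Option.some_ne_none u)
    exact walk_const T hT x x' p hp (by rw [hx]; exact Option.some_ne_none u)
  -- lifting a cut of `H`
  let lift : Finset α → Finset β := fun S => Finset.univ.filter fun x => ∃ u ∈ S, φ x = some u
  have mem_lift : ∀ (S : Finset α) (x : β) (u : α), φ x = some u → (x ∈ lift S ↔ u ∈ S) := by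
    intro S x u hx
    simp only [lift, Finset.mem_filter, Finset.mem_univ, true_and]
    constructor
    · rintro ⟨u', hu', hx'⟩
      rw [hx] at hx'
      cases Option.some_injective _ hx'
      exact hu'
    · intro hu
      exact ⟨u, hu, hx⟩
  have lift_good : ∀ S, good (lift S) := by
    intro S
    rw [good_iff]
    intro x y _ hφ hnn
    obtain ⟨u, hu⟩ := Option.ne_none_iff_exists'.1 hnn
    rw [mem_lift S x u hu, mem_lift S y u (hφ ▸ hu)]
  have lift_comp : ∀ S, cutVec G (lift S) ∘ f = cutVec H S := by
    intro S
    funext e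
    show cutVec G (lift S) ⟨s((q e).1.1, (q e).1.2), _⟩ = cutVec H S e
    refine (cutVec_mk_congr G H (lift S) S _ _ _ _ _ (hqe e) (mem_lift S _ _ (hq e).2.2.1)
      (mem_lift S _ _ (hq e).2.2.2)).trans ?_
    rw [← hqe' e]
  -- descending a good cut of `G`
  let desc : Finset β → Finset α := fun T => Finset.univ.filter fun u => ∃ x ∈ T, φ x = some u
  have mem_desc : ∀ T, good T → ∀ (x : β) (u : α), φ x = some u → (x ∈ T ↔ u ∈ desc T) := by
    intro T hT x u hx
    simp only [desc, Finset.mem_filter, Finset.mem_univ, true_and]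
    constructor
    · intro hxT
      exact ⟨x, hxT, hx⟩
    · rintro ⟨x', hx'T, hx'⟩
      exact (branch_const T hT x x' u hx hx').2 hx'T
  have desc_comp : ∀ T, good T → cutVec G T ∘ f = cutVec H (desc T) := by
    intro T hT
    funext e
    show cutVec G T ⟨s((q e).1.1, (q e).1.2), _⟩ = cutVec H (desc T) e
    refine (cutVec_mk_congr G H T (desc T) _ _ _ _ _ (hqe e) (mem_desc T hT _ _ (hq e).2.2.1)
      (mem_desc T hT _ _ (hq e).2.2.2)).trans ?_
    rw [← hqe' e]
  -- the finite point sets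
  set SG : Finset (G.edgeSet → ℝ) := Finset.univ.image (cutVec G) with hSGdef
  set SK : Finset (G.edgeSet → ℝ) := (Finset.univ.filter good).image (cutVec G) with hSKdef
  have hSG : Set.range (cutVec G) = ↑SG := by
    rw [hSGdef, Finset.coe_image, Finset.coe_univ, Set.image_univ]
  have hSK : {y | y ∈ SG ∧ ∀ g, intra g → y g = 0} = ↑SK := by
    ext y
    simp only [Set.mem_setOf_eq, hSGdef, hSKdef, Finset.coe_image, Finset.coe_filter,
      Finset.mem_image, Finset.mem_univ, true_and, Set.mem_image, Set.mem_setOf_eq]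
    constructor
    · rintro ⟨⟨T, rfl⟩, hK⟩
      exact ⟨T, hK, rfl⟩
    · rintro ⟨T, hT, rfl⟩
      exact ⟨⟨T, rfl⟩, hT⟩
  have hface : cutPolytope G ∩ K = convexHull ℝ (↑SK : Set (G.edgeSet → ℝ)) := by
    rw [cutPolytope, hSG, ← hSK]
    exact convexHull_inter_coord_zero SG {g | intra g} (fun y hy g _ => by
      obtain ⟨T, _, rfl⟩ := Finset.mem_image.1 hy
      rcases cutVec_zero_or_one G T g with h | h <;> simp [h])
  -- the linear map `x ↦ x ∘ f` carries the face onto `CUT(H)`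
  let L : (G.edgeSet → ℝ) →ₗ[ℝ] (H.edgeSet → ℝ) := LinearMap.funLeft ℝ ℝ f
  have hL : ∀ x, L x = x ∘ f := fun x => rfl
  have himage : cutPolytope H = L '' (cutPolytope G ∩ K) := by
    rw [hface, LinearMap.image_convexHull, cutPolytope]
    congr 1
    ext z
    simp only [Set.mem_range, Set.mem_image, Finset.mem_coe, hSKdef, Finset.mem_image,
      Finset.mem_filter, Finset.mem_univ, true_and, hL]
    constructor
    · rintro ⟨S, rfl⟩
      exact ⟨cutVec G (lift S), ⟨lift S, lift_good S, rfl⟩, lift_comp S⟩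
    · rintro ⟨y, ⟨T, hT, rfl⟩, rfl⟩
      exact ⟨desc T, (desc_comp T hT).symm⟩
  -- the face is free, the projection is free
  have hK : HasEFOfSize (cutPolytope G ∩ K) r := by
    have h := hG.inter_eqs (T := {g : G.edgeSet // intra g}) (fun t => Pi.single t.1 (1 : ℝ))
      (fun _ => 0)
    convert h using 2
    ext z
    simp only [K, Set.mem_setOf_eq, Subtype.forall]
    refine forall_congr' fun g => forall_congr' fun _ => ?_
    rw [dotProduct_comm, dotProduct_single, mul_one]
  rw [himage]
  exact hK.image_linearMap L

end Literature.Combinatorics.Optimization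

end
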